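import Summits.CriticalPhenomena.SAWScalingLimit.Theorems.SAWRenewalTightnessSubseqIdentificationThm65TiltedLocality
import Summits.CriticalPhenomena.SAWScalingLimit.Theorems.SAWRenewalTightnessSubseqIdentificationThm65TiltedUntilt
import Literature.Probability.RandomPlanarGeometry.SLESixHullLocalityPullback
import Literature.Probability.RandomPlanarGeometry.SimpleCurveLaws
import HarnessLib

/-!
# The tilted [LSW] Theorem 6.5 (line `boundary-area-law`, RS5b): from stopped-class locality to hull avoidance

Line `boundary-area-law` of the crux `SubseqIdentification` (stmt-CriticalPhenomena-0783), restriction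
reshape (lead c4, r-c4-3), stub RS5b `stub_thm65Tilted`. Milestone (T6) of the plan `RS5b-PLAN.md`:
for `0 < κ ≤ 4`, a nonempty `A ∈ 𝒬*` with restriction map `Φ`, a hull `B ∈ 𝒬*` and a probability
measure `Q ≪ P` on the canonical space under which the SLE_κ trace `γ` almost surely AVOIDS `A` and
which carries the image Brownian motion at every localisation level (the output (T4) of the tilted
DDS step), **`Q[γ ∩ (B·A) = ∅] = P[γ ∩ B = ∅]`** (`tilted_avoid_hullProduct_of_imageBM`) — under `Q`
the curve `Φ_A(γ)` avoids `B` with the SLE_κ probability. This is the input `htilt` of the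
un-tilting step `thm65Tilted_of_tilted` ((T7), landed) once `Q` is the tilted measure of [LSW]
Prop. 5.3 (assembly in `…Thm65TiltedAssembly.lean`).

Proof: far sets `S_R = {R ≤ ‖z‖}`, `S'_R = A ∪ {z ∈ ℍ̄ ∖ A : R ≤ ‖E_A z‖}` (closed; dictionary
`z ∈ S'_R ↔ E_A z ∈ S_R` off `A`), the landed locality identity (T5) `sle_hull_locality_of_imageBM_of_ac`
for the Borel set `(rangeSubset Bᶜ)ᶜ` of classes meeting `B`, `R → ∞` (transience; `E_A(z) ∼ z` at
`∞`), complements, and `E_A = Φ_A` on `ℍ ∖ A` with `{γ ∩ A = ∅, Φ_A(γ(0,∞)) ∩ B = ∅} = {γ ∩ (B·A) = ∅}`.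

References: [LSW] §2 p. 8 (Semigroups), §5, Prop. 5.3; Lawler–Schramm–Werner (2001) Thm. 2.2;
Rohde–Schramm (2005) Thm. 6.1, 7.1. No named fact is used.
-/

noncomputable section

open Set Filter Topology Function Complex Metric MeasureTheory ProbabilityTheory
open UpperHalfPlane (upperHalfPlaneSet)
open scoped NNReal unitInterval ENNReal
open Literature.Probability.RandomPlanarGeometry
open Literature.Probability.Process

namespace Summit.CriticalPhenomena.SAWScalingLimit.Theorems.SubseqIdentification.BoundaryAreaLaw

open Loewner

/-! ### Deterministic lemmas: stopped classes, first hits, the far sets -/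

section Deterministic

variable {A B : Set ℂ}

/-- **The trace of a stopped image class**: on the continuous branch,
`range (stoppedPathClass F γ τ) = F ∘ γ '' [0, τ]`. [folklore] -/
theorem range_stoppedPathClass {F : ℂ → ℂ} {γ : ℝ≥0 → ℂ} {τ : ℝ≥0}
    (h : Continuous fun s : I ↦ F (γ ((τ : ℝ) * s).toNNReal)) :
    (stoppedPathClass F γ τ).range = (fun r ↦ F (γ r)) '' Icc 0 τ := by
  rw [stoppedPathClass_eq h, CurveClass.range_mk]
  ext x
  simp only [Curve.mem_range, mem_image, mem_Icc]
  constructor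
  · rintro ⟨s, rfl⟩
    refine ⟨((τ : ℝ) * s).toNNReal, ⟨bot_le, ?_⟩, rfl⟩
    have hs1 : (s : ℝ) ≤ 1 := s.2.2
    have : (τ : ℝ) * s ≤ τ := by nlinarith [τ.coe_nonneg, s.2.1]
    have h2 := Real.toNNReal_le_toNNReal this
    rwa [Real.toNNReal_coe] at h2
  · rintro ⟨r, ⟨-, hr⟩, rfl⟩
    rcases eq_or_ne τ 0 with hτ | hτ
    · have hr0 : r = 0 := le_antisymm (hτ ▸ hr) bot_le
      refine ⟨⟨0, le_rfl, zero_le_one⟩, ?_⟩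
      show F (γ (((τ : ℝ) * ((⟨0, le_rfl, zero_le_one⟩ : I) : ℝ)).toNNReal)) = F (γ r)
      rw [hr0]
      norm_num
    · have hτpos : (0 : ℝ) < τ := by
        have : (0 : ℝ≥0) < τ := pos_iff_ne_zero.2 hτ
        exact_mod_cast this
      have hs : (r : ℝ) / τ ∈ I := ⟨div_nonneg r.coe_nonneg τ.coe_nonneg,
        (div_le_one hτpos).2 (by exact_mod_cast hr)⟩
      refine ⟨⟨(r : ℝ) / τ, hs⟩, ?_⟩
      show F (γ (((τ : ℝ) * ((r : ℝ) / τ)).toNNReal)) = F (γ r)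
      rw [mul_div_cancel₀ _ hτpos.ne', Real.toNNReal_coe]

/-- If a continuous path stays off the closed set `S` on `[0, s]`, then `s ≤ firstHit γ S`. [folklore] -/
theorem le_firstHit_of_forall_notMem {γ : ℝ≥0 → ℂ} (hγ : Continuous γ) {S : Set ℂ} (hS : IsClosed S)
    {s : ℝ≥0} (h : ∀ r, r ≤ s → γ r ∉ S) : (s : WithTop ℝ≥0) ≤ firstHit γ S := by
  by_contra hlt
  push Not at hlt
  have hne : firstHit γ S ≠ ⊤ := ne_top_of_lt hlt
  obtain ⟨t₀, ht₀, hmem⟩ := exists_firstHit_eq_coe hγ hS hne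
  rw [ht₀] at hlt
  exact h t₀ (WithTop.coe_lt_coe.1 hlt).le hmem

/-- The far set `S_R = {R ≤ ‖z‖}` is closed. [folklore] -/
theorem isClosed_farSet (R : ℝ) : IsClosed {z : ℂ | R ≤ ‖z‖} :=
  isClosed_le continuous_const continuous_norm

/-- **The pulled-back far set `S'_R = A ∪ {z ∈ ℍ̄ ∖ A : R ≤ ‖E_A z‖}` is closed** (`E_A` is continuous
on the closed half-plane off `A`). [folklore] -/
theorem isClosed_farSet' (hA : IsStarHull A) (R : ℝ) :
    IsClosed (A ∪ {z : ℂ | 0 ≤ z.im ∧ z ∉ A ∧ R ≤ ‖starMap A z‖}) := by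
  have hAc : IsClosed A := hA.isBoundedHull.isClosed
  refine isClosed_of_closure_subset fun z hz ↦ ?_
  by_cases hzA : z ∈ A
  · exact Or.inl hzA
  right
  rw [closure_union, hAc.closure_eq] at hz
  rcases hz with hz | hz
  · exact absurd hz hzA
  have him : 0 ≤ z.im := by
    have hsub : {z : ℂ | 0 ≤ z.im ∧ z ∉ A ∧ R ≤ ‖starMap A z‖} ⊆ {z : ℂ | 0 ≤ z.im} := fun w hw ↦ hw.1
    have hcl : IsClosed {z : ℂ | 0 ≤ z.im} := isClosed_le continuous_const Complex.continuous_im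
    exact (closure_minimal hsub hcl) hz
  refine ⟨him, hzA, ?_⟩
  obtain ⟨w, hwmem, hwlim⟩ := mem_closure_iff_seq_limit.1 hz
  have hcont : Tendsto (fun n ↦ ‖starMap A (w n)‖) atTop (𝓝 ‖starMap A z‖) :=
    ((continuous_norm.continuousAt).comp (continuousAt_starMap hA him hzA)).tendsto.comp hwlim
  exact ge_of_tendsto' hcont fun n ↦ (hwmem n).2.2

/-- The dictionary `z ∈ S'_R ↔ E_A z ∈ S_R` off `A` on the closed half-plane. [folklore] -/
theorem farSet_dict (R : ℝ) (z : ℂ) (hz : 0 ≤ z.im) (hzA : z ∉ A) :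
    z ∈ A ∪ {z : ℂ | 0 ≤ z.im ∧ z ∉ A ∧ R ≤ ‖starMap A z‖} ↔ starMap A z ∈ {z : ℂ | R ≤ ‖z‖} :=
  ⟨fun h ↦ h.elim (fun h ↦ absurd h hzA) fun h ↦ h.2.2, fun h ↦ Or.inr ⟨hz, hzA, h⟩⟩

/-- **`E_A = Φ_A` on `ℍ ∖ A` for EVERY restriction map `Φ` of `A`** (uniqueness of restriction maps).
[folklore] -/
theorem starMap_eq_of_isRestrictionMap (hA : IsStarHull A)
    {Φ : ConformalEquiv (upperHalfPlaneSet \ A) upperHalfPlaneSet} (hΦ : IsRestrictionMap A Φ) {z : ℂ}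
    (hz : z ∈ upperHalfPlaneSet \ A) : starMap A z = Φ z := by
  obtain ⟨Φ₀, -, hU⟩ := IsStarHull.existsUnique_isRestrictionMap_holds hA
  rw [starMap_of_mem_diff hA hz, hU _ (isRestrictionMap_starRMap hA) hz, ← hU Φ hΦ hz]

/-- **`‖E_A z‖ ≥ ‖z‖/2` far out in `ℍ ∖ A`** (`Φ_A(z)/z → 1`). [folklore] -/
theorem exists_norm_starMap_ge (hA : IsStarHull A) :
    ∃ r : ℝ, ∀ z : ℂ, r ≤ ‖z‖ → z ∈ upperHalfPlaneSet \ A → ‖z‖ / 2 ≤ ‖starMap A z‖ := by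
  have hev := (isRestrictionMap_starRMap hA).eventually_norm_le
  rw [Filter.eventually_inf_principal, ← Metric.cobounded_eq_cocompact] at hev
  obtain ⟨r, -, hr⟩ := (Filter.hasBasis_cobounded_norm.eventually_iff).1 hev
  refine ⟨r, fun z hrz hz ↦ ?_⟩
  rw [starMap_of_mem_diff hA hz]
  exact hr hrz hz

/-- `E_A ∘ γ` is continuous on `[0, s]` (any `s`) for a continuous path in the closed half-plane
avoiding `A`; as a map on `I` rescaled by `τ`. [folklore] -/
theorem continuous_starMap_comp_rescale (hA : IsStarHull A) {γ : ℝ≥0 → ℂ} (hγ : Continuous γ)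
    (him : ∀ t, 0 ≤ (γ t).im) (hnot : ∀ t, γ t ∉ A) (τ : ℝ≥0) :
    Continuous fun s : I ↦ starMap A (γ (((τ : ℝ) * s).toNNReal)) := by
  have hpath : Continuous fun s : I ↦ γ (((τ : ℝ) * s).toNNReal) :=
    hγ.comp (continuous_real_toNNReal.comp (continuous_const.mul continuous_subtype_val))
  exact (continuousOn_starMap hA).comp_continuous hpath fun s ↦ ⟨him _, hnot _⟩

/-- `E_A ∘ γ` is bounded on `[0, s]` for a continuous path in the closed half-plane avoiding `A`. [folklore] -/
theorem exists_bound_starMap_comp (hA : IsStarHull A) {γ : ℝ≥0 → ℂ} (hγ : Continuous γ)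
    (him : ∀ t, 0 ≤ (γ t).im) (hnot : ∀ t, γ t ∉ A) (s : ℝ≥0) :
    ∃ M : ℝ, ∀ r, r ≤ s → ‖starMap A (γ r)‖ ≤ M := by
  have hcont : ContinuousOn (fun r ↦ starMap A (γ r)) (Icc 0 s) :=
    ((continuousOn_starMap hA).comp_continuous hγ fun t ↦ ⟨him _, hnot _⟩).continuousOn
  obtain ⟨M, hM⟩ := isCompact_Icc.exists_bound_of_continuousOn hcont
  exact ⟨M, fun r hr ↦ hM r ⟨bot_le, hr⟩⟩

end Deterministic

section Main

variable {κ : ℝ≥0} {A B : Set ℂ} {Φ : ConformalEquiv (upperHalfPlaneSet \ A) upperHalfPlaneSet}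

/-- **(T6) — under a probability `Q ≪ P` avoiding `A` and carrying the image Brownian motion,
`Φ_A(γ)` avoids hulls with the SLE_κ probabilities: `Q[γ ∩ (B·A) = ∅] = P[γ ∩ B = ∅]`.** See the
module docstring for the proof. [cite: LawlerSchrammWerner2003Restriction, Prop. 5.3 with §5 and §2 p. 8 (Semigroups)] -/
theorem tilted_avoid_hullProduct_of_imageBM (hκ0 : 0 < κ) (hκ4 : κ ≤ 4) (hA : IsStarHull A) (hne : A.Nonempty)
    (hB : IsStarHull B) (hΦ : IsRestrictionMap A Φ)
    {Q : Measure (ℝ≥0 → ℝ)} [IsProbabilityMeasure Q] (hQP : Q ≪ preWienerMeasure)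
    (hQA : ∀ᵐ ω ∂Q, Disjoint (range (sleTrace κ ω)) A)
    (hBM : ∀ n : ℕ, ∃ Bc : ℝ≥0 → (ℝ≥0 → ℝ) × (ℝ≥0 → ℝ) → ℝ,
        IsBrownianReal Bc (Q.prod preWienerMeasure) ∧
        (∀ s, Measurable (Bc s)) ∧ (∀ z, Continuous (Bc · z)) ∧
        ∀ (z : (ℝ≥0 → ℝ) × (ℝ≥0 → ℝ)) (T₀ : ℝ≥0), imgLocTimeK κ hA hne n z.1 = T₀ → 0 < T₀ →
          ∀ s : ℝ≥0, (s : ℝ) ≤ imageClock (drvK κ (brownianCPath z.1)) A T₀ →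
            Real.sqrt κ * Bc s z = imageDriverC (drvK κ (brownianCPath z.1)) A T₀ s) :
    Q {ω | Disjoint (range (sleTrace κ ω)) (hullProduct B A Φ)} =
      preWienerMeasure {ω | Disjoint (range (sleTrace κ ω)) B} := by
  haveI := isProbabilityMeasure_preWienerMeasure'
  set P : Measure (ℝ≥0 → ℝ) := preWienerMeasure with hPdef
  have hκ8 : κ ≠ 8 := by intro h; rw [h] at hκ4; norm_num at hκ4
  have hAc : IsClosed A := hA.isBoundedHull.isClosed
  have hBc : IsClosed B := hB.isBoundedHull.isClosed
  have hWeq : ∀ ω, drvK κ (brownianCPath ω) = sleDriving κ ω := drvK_brownianCPath κ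
  have hγc : ∀ ω, Continuous (sleTrace κ ω) := continuous_sleTrace κ
  -- P-a.s. regularity of the trace, transferred to `Q`
  obtain ⟨-, hsimple, htrans⟩ := sle_trace_facts_of_le_four hκ0 hκ4
  have hident := ae_disjoint_closedHull_iff_lt_firstHit hκ0 hκ4 hA
  have hreg : ∀ᵐ ω ∂Q, Disjoint (range (sleTrace κ ω)) A ∧ IsSimpleTrace (sleTrace κ ω) ∧
      Tendsto (fun t ↦ ‖sleTrace κ ω t‖) atTop atTop ∧
      ∀ t, Disjoint (closedHull (sleDriving κ ω) t) A := by
    filter_upwards [hQA, hQP.ae_le hsimple, hQP.ae_le htrans, hQP.ae_le hident] with ω h1 h2 h3 h4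
    refine ⟨h1, h2, h3, fun t ↦ ?_⟩
    have hT : firstHit (sleTrace κ ω) A = ⊤ := firstHit_eq_top_iff_disjoint.2 h1
    have := (h4 t).2 (by rw [hT]; exact WithTop.coe_lt_top t)
    rwa [hWeq] at this
  -- pointwise consequences on the regular set
  have him0 : ∀ ω, IsSimpleTrace (sleTrace κ ω) → ∀ t, 0 ≤ (sleTrace κ ω t).im := fun ω hs t ↦ by
    rcases eq_or_ne t 0 with rfl | ht
    · rw [sleTrace_zero]; simp
    · exact (hs.2 t (pos_iff_ne_zero.2 ht)).le
  have hnotA : ∀ ω, Disjoint (range (sleTrace κ ω)) A → ∀ t, sleTrace κ ω t ∉ A := fun ω hd t h ↦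
    Set.disjoint_left.1 hd (mem_range_self t) h
  -- the far sets
  set S : ℕ → Set ℂ := fun R ↦ {z : ℂ | (R : ℝ) ≤ ‖z‖} with hSdef
  set S' : ℕ → Set ℂ := fun R ↦ A ∪ {z : ℂ | 0 ≤ z.im ∧ z ∉ A ∧ (R : ℝ) ≤ ‖starMap A z‖} with hS'def
  have hS : ∀ R, IsClosed (S R) := fun R ↦ isClosed_farSet _
  have hS' : ∀ R, IsClosed (S' R) := fun R ↦ isClosed_farSet' hA _
  have hdict : ∀ R (z : ℂ), 0 ≤ z.im → z ∉ A → (z ∈ S' R ↔ starMap A z ∈ S R) := fun R z hz hzA ↦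
    farSet_dict _ z hz hzA
  obtain ⟨r₀, hr₀⟩ := exists_norm_starMap_ge hA
  -- `Q`-a.s. the pulled-back far set is hit, at an alive time
  have hhit' : ∀ R : ℕ, ∀ᵐ ω ∂Q, ∃ t : ℝ≥0, firstHit (sleTrace κ ω) (S' R) = t ∧
      Disjoint (closedHull (sleDriving κ ω) t) A := by
    intro R
    filter_upwards [hreg] with ω hω
    obtain ⟨hdA, hs, htr, hal⟩ := hω
    obtain ⟨t, ht⟩ := ((htr.eventually_ge_atTop (max r₀ (2 * R))).and (eventually_ge_atTop 1)).exists
    have htpos : 0 < t := lt_of_lt_of_le one_pos ht.2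
    have hmem : sleTrace κ ω t ∈ upperHalfPlaneSet \ A := ⟨hs.2 t htpos, hnotA ω hdA t⟩
    have hge : (R : ℝ) ≤ ‖starMap A (sleTrace κ ω t)‖ := by
      have h1 := hr₀ _ ((le_max_left _ _).trans ht.1) hmem
      have h2 : 2 * (R : ℝ) ≤ ‖sleTrace κ ω t‖ := (le_max_right _ _).trans ht.1
      linarith
    have htS' : sleTrace κ ω t ∈ S' R := Or.inr ⟨him0 ω hs t, hnotA ω hdA t, hge⟩
    have hne' : firstHit (sleTrace κ ω) (S' R) ≠ ⊤ := ne_top_of_le_ne_top WithTop.coe_ne_top (firstHit_le htS')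
    obtain ⟨t₀, ht₀, -⟩ := exists_firstHit_eq_coe (hγc ω) (hS' R) hne'
    exact ⟨t₀, ht₀, hal t₀⟩
  -- `P`-a.s. the far set is hit
  have hhit : ∀ R : ℕ, ∀ᵐ ω ∂P, ∃ t : ℝ≥0, firstHit (sleTrace κ ω) (S R) = t := by
    intro R
    filter_upwards [htrans] with ω htr
    obtain ⟨t, ht⟩ := (htr.eventually_ge_atTop R).exists
    have hne' : firstHit (sleTrace κ ω) (S R) ≠ ⊤ := ne_top_of_le_ne_top WithTop.coe_ne_top (firstHit_le ht)
    obtain ⟨t₀, ht₀, -⟩ := exists_firstHit_eq_coe (hγc ω) (hS R) hne'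
    exact ⟨t₀, ht₀⟩
  -- the test set: classes meeting `B`
  set T : Set (CurveClass ℂ) := (CurveClass.rangeSubset Bᶜ)ᶜ with hTdef
  have hT : MeasurableSet T := (CurveClass.measurableSet_rangeSubset_compl hBc).compl
  -- the approximating events
  set G : ℕ → Set (ℝ≥0 → ℝ) := fun R ↦ {ω | ∃ s : ℝ≥0, (s : WithTop ℝ≥0) ≤ firstHit (sleTrace κ ω) (S' R) ∧
    starMap A (sleTrace κ ω s) ∈ B} with hGdef
  set G' : ℕ → Set (ℝ≥0 → ℝ) := fun R ↦ {ω | ∃ s : ℝ≥0, (s : WithTop ℝ≥0) ≤ firstHit (sleTrace κ ω) (S R) ∧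
    sleTrace κ ω s ∈ B} with hG'def
  have hmonoS : ∀ {R R' : ℕ}, R ≤ R' → S R' ⊆ S R := fun {R R'} hRR' z hz ↦
    le_trans (show ((R : ℕ) : ℝ) ≤ R' by exact_mod_cast hRR') hz
  have hmonoS' : ∀ {R R' : ℕ}, R ≤ R' → S' R' ⊆ S' R := by
    intro R R' hRR' z hz
    rcases hz with hz | hz
    · exact Or.inl hz
    · have h1 : ((R : ℕ) : ℝ) ≤ R' := by exact_mod_cast hRR'
      exact Or.inr ⟨hz.1, hz.2.1, h1.trans hz.2.2⟩
  have hmonoG : Monotone G := fun R R' hRR' ω ⟨s, hs, hsB⟩ ↦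
    ⟨s, hs.trans (firstHit_mono _ (hmonoS' hRR')), hsB⟩
  have hmonoG' : Monotone G' := fun R R' hRR' ω ⟨s, hs, hsB⟩ ↦
    ⟨s, hs.trans (firstHit_mono _ (hmonoS hRR')), hsB⟩
  -- Step 1: `Q (G R) = P (G' R)` for every `R`, from the stopped-class locality identity
  have hstep : ∀ R : ℕ, Q (G R) = P (G' R) := by
    intro R
    have hloc := sle_hull_locality_of_imageBM_of_ac hκ0 hκ8 hA hne hQP hBM (hS R) (hS' R) (hdict R) (hhit' R) hT
    have hGae : G R =ᵐ[Q] ({ω | stoppedPathClass (starMap A) (sleTrace κ ω)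
        ((firstHit (sleTrace κ ω) (S' R)).untopD 0) ∈ T} : Set (ℝ≥0 → ℝ)) := by
      filter_upwards [hreg, hhit' R] with ω hω hω'
      obtain ⟨hdA, hs, -, -⟩ := hω
      obtain ⟨t₀, ht₀, -⟩ := hω'
      have hcont := continuous_starMap_comp_rescale hA (hγc ω) (him0 ω hs) (hnotA ω hdA) t₀
      have key : ω ∈ G R ↔ stoppedPathClass (starMap A) (sleTrace κ ω)
          ((firstHit (sleTrace κ ω) (S' R)).untopD 0) ∈ T := by
        show (∃ s : ℝ≥0, (s : WithTop ℝ≥0) ≤ firstHit (sleTrace κ ω) (S' R) ∧ starMap A (sleTrace κ ω s) ∈ B) ↔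
          stoppedPathClass (starMap A) (sleTrace κ ω) ((firstHit (sleTrace κ ω) (S' R)).untopD 0) ∈
            (CurveClass.rangeSubset Bᶜ)ᶜ
        rw [ht₀, WithTop.untopD_coe, mem_compl_iff, ← CurveClass.disjoint_range_iff, range_stoppedPathClass hcont,
          Set.not_disjoint_iff]
        constructor
        · rintro ⟨s, hs, hsB⟩
          exact ⟨_, ⟨s, ⟨bot_le, WithTop.coe_le_coe.1 hs⟩, rfl⟩, hsB⟩
        · rintro ⟨x, ⟨s, hs, rfl⟩, hsB⟩
          exact ⟨s, WithTop.coe_le_coe.2 hs.2, hsB⟩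
      exact propext key
    have hG'ae : G' R =ᵐ[P] ({ω | stoppedPathClass id (sleTrace κ ω)
        ((firstHit (sleTrace κ ω) (S R)).untopD 0) ∈ T} : Set (ℝ≥0 → ℝ)) := by
      filter_upwards [hhit R] with ω hω
      obtain ⟨t₀, ht₀⟩ := hω
      have hcont : Continuous fun s : I ↦ id (sleTrace κ ω (((t₀ : ℝ) * s).toNNReal)) :=
        (hγc ω).comp (continuous_real_toNNReal.comp (continuous_const.mul continuous_subtype_val))
      have key : ω ∈ G' R ↔ stoppedPathClass id (sleTrace κ ω)
          ((firstHit (sleTrace κ ω) (S R)).untopD 0) ∈ T := by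
        show (∃ s : ℝ≥0, (s : WithTop ℝ≥0) ≤ firstHit (sleTrace κ ω) (S R) ∧ sleTrace κ ω s ∈ B) ↔
          stoppedPathClass id (sleTrace κ ω) ((firstHit (sleTrace κ ω) (S R)).untopD 0) ∈
            (CurveClass.rangeSubset Bᶜ)ᶜ
        rw [ht₀, WithTop.untopD_coe, mem_compl_iff, ← CurveClass.disjoint_range_iff, range_stoppedPathClass hcont,
          Set.not_disjoint_iff]
        constructor
        · rintro ⟨s, hs, hsB⟩
          exact ⟨_, ⟨s, ⟨bot_le, WithTop.coe_le_coe.1 hs⟩, rfl⟩, hsB⟩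
        · rintro ⟨x, ⟨s, hs, rfl⟩, hsB⟩
          exact ⟨s, WithTop.coe_le_coe.2 hs.2, hsB⟩
      exact propext key
    rw [measure_congr hGae, measure_congr hG'ae, hloc]
  -- Step 2: the unions
  set Ginf : Set (ℝ≥0 → ℝ) := {ω | ∃ s : ℝ≥0, starMap A (sleTrace κ ω s) ∈ B} with hGinf
  set G'inf : Set (ℝ≥0 → ℝ) := {ω | ∃ s : ℝ≥0, sleTrace κ ω s ∈ B} with hG'inf
  have hUG : (⋃ R, G R) =ᵐ[Q] Ginf := by
    filter_upwards [hreg] with ω hω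
    obtain ⟨hdA, hs, -, -⟩ := hω
    refine propext ⟨?_, ?_⟩
    · intro h
      obtain ⟨R, s, -, hsB⟩ := mem_iUnion.1 h
      exact ⟨s, hsB⟩
    · rintro ⟨s, hsB⟩
      obtain ⟨M, hM⟩ := exists_bound_starMap_comp hA (hγc ω) (him0 ω hs) (hnotA ω hdA) s
      obtain ⟨R, hR⟩ := exists_nat_gt M
      refine mem_iUnion.2 ⟨R, s, le_firstHit_of_forall_notMem (hγc ω) (hS' R) fun r hr hmem ↦ ?_, hsB⟩
      rcases hmem with hmem | hmem
      · exact hnotA ω hdA r hmem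
      · have := hM r hr; linarith [hmem.2.2]
  have hUG' : (⋃ R, G' R) =ᵐ[P] G'inf := by
    refine Eventually.of_forall fun ω ↦ propext ⟨?_, ?_⟩
    · intro h
      obtain ⟨R, s, -, hsB⟩ := mem_iUnion.1 h
      exact ⟨s, hsB⟩
    · rintro ⟨s, hsB⟩
      obtain ⟨M, hM⟩ := isCompact_Icc.exists_bound_of_continuousOn ((hγc ω).continuousOn (s := Icc 0 s))
      obtain ⟨R, hR⟩ := exists_nat_gt M
      refine mem_iUnion.2 ⟨R, s, le_firstHit_of_forall_notMem (hγc ω) (hS R) fun r hr hmem ↦ ?_, hsB⟩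
      have := hM r ⟨bot_le, hr⟩
      have h2 : (R : ℝ) ≤ ‖sleTrace κ ω r‖ := hmem
      linarith
  have hlimG : Tendsto (fun R ↦ Q (G R)) atTop (𝓝 (Q Ginf)) := by
    rw [← measure_congr hUG]; exact tendsto_measure_iUnion_atTop hmonoG
  have hlimG' : Tendsto (fun R ↦ P (G' R)) atTop (𝓝 (P G'inf)) := by
    rw [← measure_congr hUG']; exact tendsto_measure_iUnion_atTop hmonoG'
  have heq : Q Ginf = P G'inf := by
    refine tendsto_nhds_unique hlimG ?_
    simp_rw [hstep]; exact hlimG'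
  -- Step 3: complements
  have hDB : ({ω | Disjoint (range (sleTrace κ ω)) B} : Set (ℝ≥0 → ℝ)) = G'infᶜ := by
    ext ω
    simp only [mem_setOf_eq, mem_compl_iff, hG'inf, not_exists, Set.disjoint_left, mem_range,
      forall_exists_index, forall_apply_eq_imp_iff]
  have hDBA : ({ω | Disjoint (range (sleTrace κ ω)) (hullProduct B A Φ)} : Set (ℝ≥0 → ℝ)) =ᵐ[Q] Ginfᶜ := by
    have hP : IsStarHull (hullProduct B A Φ) := hB.hullProduct hA hΦ
    filter_upwards [hreg] with ω hω
    obtain ⟨hdA, hs, -, -⟩ := hω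
    have h0 : sleTrace κ ω 0 = 0 := sleTrace_zero κ ω
    have key : Disjoint (range (sleTrace κ ω)) (hullProduct B A Φ) ↔ ω ∉ Ginf := by
      rw [disjoint_range_hullProduct_iff hBc hAc hA.zero_notMem hP.zero_notMem h0 hs.2]
      simp only [hGinf, mem_setOf_eq, not_exists]
      constructor
      · rintro ⟨-, h⟩ s hsB
        rcases eq_or_ne s 0 with rfl | hs0
        · rw [h0, starMap_zero hA] at hsB; exact hB.zero_notMem hsB
        · have hspos : 0 < s := pos_iff_ne_zero.2 hs0
          rw [starMap_eq_of_isRestrictionMap hA hΦ ⟨hs.2 s hspos, hnotA ω hdA s⟩] at hsB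
          exact h s hspos hsB
      · intro h
        refine ⟨hdA, fun t ht hmem ↦ h t ?_⟩
        rwa [starMap_eq_of_isRestrictionMap hA hΦ ⟨hs.2 t ht, hnotA ω hdA t⟩]
    exact propext key
  have hnullB : NullMeasurableSet ({ω | Disjoint (range (sleTrace κ ω)) B} : Set (ℝ≥0 → ℝ)) P :=
    nullMeasurableSet_setOf_disjoint hκ8 hBc
  have hnullBA : NullMeasurableSet ({ω | Disjoint (range (sleTrace κ ω)) (hullProduct B A Φ)} : Set (ℝ≥0 → ℝ)) Q :=
    (nullMeasurableSet_setOf_disjoint hκ8 (hB.hullProduct hA hΦ).isBoundedHull.isClosed).mono_ac hQP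
  have hnullGinf : NullMeasurableSet Ginf Q := by
    have h1 : NullMeasurableSet Ginfᶜ Q := hnullBA.congr hDBA
    have h2 := h1.compl
    rwa [compl_compl] at h2
  have hnullG'inf : NullMeasurableSet G'inf P := by
    have h1 : NullMeasurableSet G'infᶜ P := by rw [← hDB]; exact hnullB
    have h2 := h1.compl
    rwa [compl_compl] at h2
  have e1 : Q Ginfᶜ = 1 - Q Ginf := prob_compl_eq_one_sub₀ hnullGinf
  have e2 : P G'infᶜ = 1 - P G'inf := prob_compl_eq_one_sub₀ hnullG'inf
  calc Q {ω | Disjoint (range (sleTrace κ ω)) (hullProduct B A Φ)} = Q Ginfᶜ := measure_congr hDBA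
    _ = 1 - Q Ginf := e1
    _ = 1 - P G'inf := by rw [heq]
    _ = P G'infᶜ := e2.symm
    _ = P {ω | Disjoint (range (sleTrace κ ω)) B} := by rw [hDB]

/-- **(T6), registered form** (explicit-binder restatement of `tilted_avoid_hullProduct_of_imageBM` for the
stub registry of stmt-CriticalPhenomena-0783). [cite: LawlerSchrammWerner2003Restriction, Prop. 5.3 with §5 and §2 p. 8 (Semigroups)] -/
theorem tilted_avoid_hullProduct_of_imageBM' :
    ∀ (κ : ℝ≥0), 0 < κ → κ ≤ 4 → ∀ (A B : Set ℂ) (hA : IsStarHull A) (hne : A.Nonempty), IsStarHull B →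
      ∀ (Φ : ConformalEquiv (upperHalfPlaneSet \ A) upperHalfPlaneSet), IsRestrictionMap A Φ →
      ∀ (Q : Measure (ℝ≥0 → ℝ)), IsProbabilityMeasure Q → Q ≪ preWienerMeasure →
      (∀ᵐ ω ∂Q, Disjoint (range (sleTrace κ ω)) A) →
      (∀ n : ℕ, ∃ Bc : ℝ≥0 → (ℝ≥0 → ℝ) × (ℝ≥0 → ℝ) → ℝ,
        IsBrownianReal Bc (Q.prod preWienerMeasure) ∧
        (∀ s, Measurable (Bc s)) ∧ (∀ z, Continuous (Bc · z)) ∧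
        ∀ (z : (ℝ≥0 → ℝ) × (ℝ≥0 → ℝ)) (T₀ : ℝ≥0), imgLocTimeK κ hA hne n z.1 = T₀ → 0 < T₀ →
          ∀ s : ℝ≥0, (s : ℝ) ≤ Loewner.imageClock (drvK κ (brownianCPath z.1)) A T₀ →
            Real.sqrt κ * Bc s z = Loewner.imageDriverC (drvK κ (brownianCPath z.1)) A T₀ s) →
      Q {ω | Disjoint (range (sleTrace κ ω)) (hullProduct B A Φ)} =
        preWienerMeasure {ω | Disjoint (range (sleTrace κ ω)) B} := by
  intro κ hκ0 hκ4 A B hA hne hB Φ hΦ Q hQ hQP hQA hBM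
  exact tilted_avoid_hullProduct_of_imageBM hκ0 hκ4 hA hne hB hΦ hQP hQA hBM

end Main

end Summit.CriticalPhenomena.SAWScalingLimit.Theorems.SubseqIdentification.BoundaryAreaLaw

end
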